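import Mathlib

/-!
# `BalabanUV.Beta.FP.PackedRepacking` — road «FP» for binder row D1, ROUTE T, RULING R-FP-57 (R2) (journal [D1P3-G21-RFP57]; memo `N2B-DESIGN.md` §30 (30h),
# TID § F.10 (L1)): **PACKED JETS REPACK ALONG A LINEAR CHANGE OF DIRECTION** — the door packed over FINEST-level bonds `b ∈ β` along `h = C·h̄` is packed
# over TOP-level bonds `ā ∈ α` along `h̄`, with the per-bond tables pushed through `C`

WHY.  R-FP-57 reads the (STEP) door (#21, base level 0, depth `j−1`) along the directions `h := col_{j+1}·h̄` in the image of the one-shot column and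
packs it over the TOP-level bonds (`SecondVarKernelLaw` #20 with `σ := α`), so that its three kernels become an4's `StepRecursion` terms.  The door's tables
arrive packed over the finest bonds — first jets `Σ_b h b • T₁ b`, second jets `Σ_{b,b′} h b·h b′ • T₂ b b′` —; along `h = C·h̄` they ARE packed over `α`
with the repacked tables `T̄₁ ā := Σ_b C b ā • T₁ b`, `T̄₂ ā ā′ := Σ_{b,b′} (C b ā·C b′ ā′) • T₂ b b′`.  This file is that [folklore] bookkeeping (any
module `M` over `ℝ`, finite index types): §1 `sum_smul_repack`, §2 `sum_sum_smul_repack`, §3 `repack₂_symm` (symmetric families repack to symmetric families —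
#20's hypothesis is preserved).  No `def`, no `def … : Prop`, nothing cited, 0 sorry; 0 estimates.

HONEST DEPENDENCY (page 1, mandatory): continuum YM on T⁴ ⇐ BetaPertH ∧ nine spine estimates (0/9 proved); BetaPertH ⇐ (D1) ∧ (D4) ∧ CAP+tail;
G-an2-4 gates asym, D1 and NE2/3/4.  HONEST FRAMING (cell contract, verbatim): «discharging `BetaPertH` makes Bałaban's UV stability UNCONDITIONAL —
a real constructive-QFT result; it is NOT the continuum limit and NOT the Clay problem.»  ABSOLUTE RULE (cell charter, verbatim): «No internally-minted
statement may enter as a cited fact. Every hypothesis is either kernel-proved in this package or a verbatim quotation of a PUBLISHED theorem with page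
reference. The manuscript(s) under audit are NOT citable for their own disputed steps — they are the thing under adjudication; programme-internal
(2001/route/tribunal) claims are never citable.»  [folklore] finite sums; nothing of Bałaban's asserted; 0∕4 row-D1 binders; NOT (T-ID), NOT SDF, NOT D1,
NOT BetaPertH, NOT continuum, NOT Clay.  Road «FP» OWNER, b2b-balaban-beta-d1-p3 gen 21, 2026-08-22.  No existing file touched.
-/

namespace Summit.QuantumFields.BalabanUV.Beta.FP.PackedRepacking

open scoped BigOperators

variable {α β M : Type*} [Fintype α] [Fintype β] [AddCommGroup M] [Module ℝ M]

/-! ## §1 First jets -/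

/-- [folklore] **FIRST JETS REPACK**: along `h b := Σ_ā C b ā·r ā`, `Σ_b h b • T b = Σ_ā r ā • (Σ_b C b ā • T b)`. -/
theorem sum_smul_repack (C : β → α → ℝ) (r : α → ℝ) (T : β → M) :
    ∑ b, (∑ a, C b a * r a) • T b = ∑ a, r a • ∑ b, C b a • T b := by
  simp only [Finset.sum_smul, Finset.smul_sum, smul_smul]
  rw [Finset.sum_comm]
  refine Finset.sum_congr rfl fun a _ => Finset.sum_congr rfl fun b _ => ?_
  rw [mul_comm]

/-! ## §2 Second jets -/

/-- [folklore] **SECOND JETS REPACK**: along `h = C·r`,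
`Σ_{b,b′} (h b·h b′) • T₂ b b′ = Σ_{ā,ā′} (r ā·r ā′) • (Σ_{b,b′} (C b ā·C b′ ā′) • T₂ b b′)`. -/
theorem sum_sum_smul_repack (C : β → α → ℝ) (r : α → ℝ) (T₂ : β → β → M) :
    ∑ b, ∑ b', ((∑ a, C b a * r a) * (∑ a', C b' a' * r a')) • T₂ b b'
      = ∑ a, ∑ a', (r a * r a') • ∑ b, ∑ b', (C b a * C b' a') • T₂ b b' := by
  -- both sides are the quadruple sum `Σ (r a·r a′·(C b a·C b′ a′)) • T₂ b b′`, summed in different orders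
  have hL : ∀ b b' : β, ((∑ a, C b a * r a) * (∑ a', C b' a' * r a')) • T₂ b b'
      = ∑ a, ∑ a', (r a * r a' * (C b a * C b' a')) • T₂ b b' := by
    intro b b'
    have hprod : (∑ a, C b a * r a) * (∑ a', C b' a' * r a') = ∑ a, ∑ a', r a * r a' * (C b a * C b' a') := by
      rw [Finset.sum_mul_sum]
      refine Finset.sum_congr rfl fun a _ => Finset.sum_congr rfl fun a' _ => ?_
      ring
    rw [hprod, Finset.sum_smul]
    exact Finset.sum_congr rfl fun a _ => Finset.sum_smul
  have hR : ∀ a a' : α, (r a * r a') • ∑ b, ∑ b', (C b a * C b' a') • T₂ b b'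
      = ∑ b, ∑ b', (r a * r a' * (C b a * C b' a')) • T₂ b b' := by
    intro a a'
    simp only [Finset.smul_sum, smul_smul]
  simp only [hL, hR]
  -- reorder `Σ_b Σ_b′ Σ_a Σ_a′ = Σ_a Σ_a′ Σ_b Σ_b′`
  calc ∑ b, ∑ b', ∑ a, ∑ a', (r a * r a' * (C b a * C b' a')) • T₂ b b'
      = ∑ b, ∑ a, ∑ b', ∑ a', (r a * r a' * (C b a * C b' a')) • T₂ b b' :=
        Finset.sum_congr rfl fun b _ => Finset.sum_comm
    _ = ∑ a, ∑ b, ∑ b', ∑ a', (r a * r a' * (C b a * C b' a')) • T₂ b b' := Finset.sum_comm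
    _ = ∑ a, ∑ b, ∑ a', ∑ b', (r a * r a' * (C b a * C b' a')) • T₂ b b' :=
        Finset.sum_congr rfl fun a _ => Finset.sum_congr rfl fun b _ => Finset.sum_comm
    _ = ∑ a, ∑ a', ∑ b, ∑ b', (r a * r a' * (C b a * C b' a')) • T₂ b b' :=
        Finset.sum_congr rfl fun a _ => Finset.sum_comm

/-! ## §3 Symmetric families repack to symmetric families -/

omit [Fintype α] in
/-- [folklore] If `T₂ b b′ = T₂ b′ b` then the repacked family `T̄₂ ā ā′ := Σ_{b,b′} (C b ā·C b′ ā′) • T₂ b b′` is symmetric in `(ā, ā′)` — so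
`SecondVarKernelLaw`'s symmetry hypothesis survives the repacking. -/
theorem repack₂_symm (C : β → α → ℝ) (T₂ : β → β → M) (hT : ∀ b b', T₂ b b' = T₂ b' b) (a a' : α) :
    ∑ b, ∑ b', (C b a * C b' a') • T₂ b b' = ∑ b, ∑ b', (C b a' * C b' a) • T₂ b b' := by
  rw [Finset.sum_comm]
  refine Finset.sum_congr rfl fun b _ => Finset.sum_congr rfl fun b' _ => ?_
  rw [hT b' b, mul_comm]

end Summit.QuantumFields.BalabanUV.Beta.FP.PackedRepacking
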